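import Summits.CriticalPhenomena.PercolationContinuityZ3.Theorems.PercNearOneGluingNoHeavyLowerTailSahiSubsetChord

/-!
# `NoHeavyLowerTail` (stmt-CriticalPhenomena-4575) — subset chord superlinearity implies Sahi's `C₃` on every product cube

Support file, seat `prim-l12-p5`, `--supports stmt-CriticalPhenomena-4575`.  PROVES the reduction announced in `…SahiSubsetChord`:
`sahiE_three_nonneg_of_subsetChordSuperlinear : SubsetChordSuperlinear → ∀ ι q f (product weight, monotone indicator triple), 0 ≤ E₃`,
by strong induction on the number of coordinates: for `|ι| ≥ 2` the conjecture gives a nonempty proper `S` with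
`E₃(f) ≥ Σ_v w(v)·E₃(section at x_S = v)`, every section is a monotone indicator triple on the strictly smaller cube `{i ∉ S} → Bool`,
and the weights are nonnegative; `|ι| = 0` is the one-point space (`E₃ = 0`) and `|ι| = 1` is the one-coin inequality (27 cases of
three monotone `{0,1}`-valued functions on one bit: `E₃ ∈ {0, p(1−p), p(1−p)(2−p)}`).  No definitions, no named facts; the hypothesis
`SubsetChordSuperlinear` is the tree's `@[conjecture]` (census-alive, module form), NOT asserted.
-/

namespace Summit.CriticalPhenomena.PercolationContinuityZ3.Theorems

namespace SahiSubsetChord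

open Finset Literature.Combinatorics.Sahi2008

/-- The product weight is nonnegative for `q ∈ [0,1]^ι`. [folklore] -/
theorem prodWeight_nonneg {ι : Type*} [Fintype ι] [DecidableEq ι] {q : ι → ℝ} (hq : ∀ i, 0 ≤ q i ∧ q i ≤ 1)
    (x : ι → Bool) : 0 ≤ prodWeight q x := by
  unfold prodWeight
  refine Finset.prod_nonneg fun i _ => ?_
  split_ifs
  · exact (hq i).1
  · linarith [(hq i).2]

/-- Gluing is monotone in the free coordinates. [folklore] -/
theorem glue_mono {ι : Type*} [Fintype ι] [DecidableEq ι] (S : Finset ι) (v : {i // i ∈ S} → Bool) :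
    Monotone (glue S v) := by
  intro y y' h i
  unfold glue
  split_ifs with hi
  · exact le_rfl
  · exact h ⟨i, hi⟩

/-- `E₃ = 0` on a cube with no coordinates (one configuration, weight `1`). [folklore] -/
theorem sahiE_three_of_isEmpty {ι : Type} [Fintype ι] [DecidableEq ι] [IsEmpty ι] (q : ι → ℝ)
    (f : Fin 3 → (ι → Bool) → ℝ) : sahiE (prodWeight q) 3 f = 0 := by
  rw [sahiE_three_apply]
  simp only [ex, Fintype.sum_unique, prodWeight, Fintype.prod_empty, one_mul, Pi.mul_apply]
  ring

/-- The ONE-COIN inequality: three monotone `{0,1}`-valued functions of one bit have `E₃ ≥ 0`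
(`E₃ ∈ {0, p(1−p), p(1−p)(2−p)}`). [folklore] -/
theorem sahiE_three_nonneg_of_card_eq_one {ι : Type} [Fintype ι] [DecidableEq ι] (hι : Fintype.card ι = 1)
    (q : ι → ℝ) (hq : ∀ i, 0 ≤ q i ∧ q i ≤ 1) (f : Fin 3 → (ι → Bool) → ℝ)
    (hind : ∀ a x, f a x = 0 ∨ f a x = 1) (hmono : ∀ a, Monotone (f a)) : 0 ≤ sahiE (prodWeight q) 3 f := by
  obtain ⟨hu⟩ := Fintype.card_eq_one_iff_nonempty_unique.mp hι
  letI : Unique ι := hu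
  have hsum : ∀ g : (ι → Bool) → ℝ, ∑ x, g x = g (fun _ => false) + g (fun _ => true) := by
    intro g
    rw [← (Equiv.funUnique ι Bool).symm.sum_comp, Fintype.sum_bool, add_comm]
    rfl
  have hw : ∀ b : Bool, prodWeight q (fun _ : ι => b) = if b then q default else 1 - q default := by
    intro b; simp only [prodWeight, Fintype.prod_unique]
  set p := q default with hp_def
  have hp0 : 0 ≤ p := (hq default).1
  have hp1 : p ≤ 1 := (hq default).2
  have hcases : ∀ a, (f a (fun _ => false) = 0 ∧ f a (fun _ => true) = 0) ∨
      (f a (fun _ => false) = 0 ∧ f a (fun _ => true) = 1) ∨ (f a (fun _ => false) = 1 ∧ f a (fun _ => true) = 1) := by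
    intro a
    have hle : f a (fun _ => false) ≤ f a (fun _ => true) := hmono a (fun _ => Bool.false_le _)
    rcases hind a (fun _ => false) with h0 | h0 <;> rcases hind a (fun _ => true) with h1 | h1
    · exact Or.inl ⟨h0, h1⟩
    · exact Or.inr (Or.inl ⟨h0, h1⟩)
    · exfalso; rw [h0, h1] at hle; linarith
    · exact Or.inr (Or.inr ⟨h0, h1⟩)
  rw [sahiE_three_apply]
  simp only [ex, hsum, hw, Pi.mul_apply, if_true, Bool.false_eq_true, if_false]
  have key : 0 ≤ p * (1 - p) := mul_nonneg hp0 (by linarith)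
  have key2 : 0 ≤ p * (1 - p) * (2 - p) := mul_nonneg key (by linarith)
  rcases hcases 0 with ⟨a0, a1⟩ | ⟨a0, a1⟩ | ⟨a0, a1⟩ <;>
    rcases hcases 1 with ⟨b0, b1⟩ | ⟨b0, b1⟩ | ⟨b0, b1⟩ <;>
    rcases hcases 2 with ⟨c0, c1⟩ | ⟨c0, c1⟩ | ⟨c0, c1⟩ <;>
    simp only [a0, a1, b0, b1, c0, c1] <;> nlinarith [key, key2, hp0, hp1]

/-- **Reduction.**  Subset chord superlinearity (the tree's `@[conjecture] SubsetChordSuperlinear`) implies `E₃ ≥ 0` for every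
triple of monotone indicator functions on every finite product cube — the product-measure case of Sahi's `C₃` / Kahn's Conjecture 5
for indicator triples (strong induction on the number of coordinates). [this file] -/
theorem sahiE_three_nonneg_of_subsetChordSuperlinear (H : SubsetChordSuperlinear) :
    ∀ (n : ℕ) (ι : Type) [Fintype ι] [DecidableEq ι], Fintype.card ι = n →
      ∀ (q : ι → ℝ), (∀ i, 0 ≤ q i ∧ q i ≤ 1) →
        ∀ f : Fin 3 → (ι → Bool) → ℝ, (∀ a x, f a x = 0 ∨ f a x = 1) → (∀ a, Monotone (f a)) →
          0 ≤ sahiE (prodWeight q) 3 f := by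
  intro n
  induction n using Nat.strong_induction_on with
  | _ n ih =>
    intro ι _ _ hcard q hq f hind hmono
    rcases Nat.lt_or_ge n 2 with hn | hn
    · interval_cases n
      · haveI : IsEmpty ι := Fintype.card_eq_zero_iff.mp hcard
        rw [sahiE_three_of_isEmpty]
      · exact sahiE_three_nonneg_of_card_eq_one hcard q hq f hind hmono
    · obtain ⟨S, hSne, -, hle⟩ := H ι (hcard ▸ hn) q hq f hind hmono
      refine le_trans (Finset.sum_nonneg fun v _ => mul_nonneg
        (prodWeight_nonneg (q := fun i : {i // i ∈ S} => q i) (fun i => hq i) v) ?_) hle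
      have hlt : Fintype.card {i // i ∉ S} < n := by
        rw [← hcard]
        obtain ⟨i₀, hi₀⟩ := hSne
        exact Fintype.card_subtype_lt fun h => h hi₀
      exact ih _ hlt {i // i ∉ S} rfl (fun i => q i) (fun i => hq i) (fun a y => f a (glue S v y))
        (fun a y => hind a _) (fun a => (hmono a).comp (glue_mono S v))

/-- Corollary in the shape of the conjecture's promise: `SubsetChordSuperlinear → E₃ ≥ 0` on every finite product cube.
[this file] -/
theorem sahiE_three_nonneg_of_SCS (H : SubsetChordSuperlinear) {ι : Type} [Fintype ι] [DecidableEq ι] (q : ι → ℝ)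
    (hq : ∀ i, 0 ≤ q i ∧ q i ≤ 1) (f : Fin 3 → (ι → Bool) → ℝ) (hind : ∀ a x, f a x = 0 ∨ f a x = 1)
    (hmono : ∀ a, Monotone (f a)) : 0 ≤ sahiE (prodWeight q) 3 f :=
  sahiE_three_nonneg_of_subsetChordSuperlinear H _ ι rfl q hq f hind hmono

end SahiSubsetChord

end Summit.CriticalPhenomena.PercolationContinuityZ3.Theorems
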